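import Mathlib
import Summits.Ventures.PercRepro2.Defs
import Summits.Ventures.PercRepro2.Independence
import Summits.Ventures.PercRepro2.Harris
import Summits.Ventures.PercRepro2.Graph
import Summits.Ventures.PercRepro2.Events
import Summits.Ventures.PercRepro2.Induced
import Summits.Ventures.PercRepro2.BHKEvents
import Summits.Ventures.PercRepro2.ContractDefs
import Summits.Ventures.PercRepro2.CCTWRoot

/-!
# Row 2′CON-W, form (CCT-W): the between-fibre reduction along the cluster of the avoided vertex
(blind cell PercRepro2, mine-1 g28; `conjectures/MINE-1.md` §39 (4), `proofs/MINE1-J1.md` §30 (b3)(ii))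

Explore the cluster `H = C_{H/W}(t)` of the avoided vertex `t` in the contracted graph `H/W`
(`contractEnds ends W w₀`).  Given `H`, the rest of `H/W` is product, and the merged connection
probabilities of the root `s` are the **residual probabilities** `x̂(H) = P(a ∈ C_s in H/W ∖ H)`
(`resProb`, an instance of `delClusterProb`), antitone in `H`.  With `Q₀ = P(R_T)`,
`X₀ = P(a ∈ C_s; R_T)`, `Y₀ = P(b ∈ C_s; R_T)` the plain quantities, the **between-fibre form**

  `betweenFibre = E_{H/W}[(x̂(C_t) Q₀ − X₀) (ŷ(C_t) Q₀ − Y₀); s ↛ t]`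

is (CCT-W) with the within-fibre covariances dropped, and

* `CCTW_of_betweenFibre`: `0 ≤ betweenFibre → CCTW` — the dropped terms are the Harris covariances
  of the residual product measures (`resProb_mul_resProb_le_resProb2`), so (CCT-W) follows from the
  between-fibre form (census: the between-fibre form is ≥ 0 on 300 / 300 fine-grid cells, §39 (4));
* `Khat_nonneg`: the between-fibre BHK slack `K̂₁ = Q₁ Ẑ₁ − X₁ Y₁ ≥ 0`, `Ẑ₁ = E[x̂ ŷ(C_t); s ↛ t]`
  — BHK 1.3 (`bhk_same_cluster`) on `H/W` for the cluster of `t` with the antitone functionals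
  `x̂, ŷ`;
* `betweenFibre_anatomy`: `Q₁ · betweenFibre = Q₀² · K̂₁ + (X₁ Q₀ − X₀ Q₁)(Y₁ Q₀ − Y₀ Q₁)` — so the
  open content of the free-edge rung is exactly «the between-fibre slack of `H/W` dominates the
  product of the two displacements» (`CCTW_of_slack`); for a root or a marker inside `W` the
  displacements are co-monotone (CCTWRoot.lean, CCTMarker.lean) and the slack is not needed.
-/

namespace Summit.Ventures.PercRepro2

namespace Contract

/-! ## Residual connection probabilities -/

section Residual

variable {V : Type*} {E : Type*} [Fintype E] [DecidableEq E] {R : Type*} [CommRing R]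

/-- `resProb p ends s a W = P(a ∈ C_s in G ∖ W)`: the probability that `s` reaches `a` after
closing every edge touching `W`. -/
noncomputable def resProb (p : E → R) (ends : E → Sym2 V) (s a : V) (W : Set V) : R :=
  delClusterProb p ends s {S : Set V | a ∈ S} W

/-- `resProb2 p ends s a b W = P(a, b ∈ C_s in G ∖ W)`. -/
noncomputable def resProb2 (p : E → R) (ends : E → Sym2 V) (s a b : V) (W : Set V) : R :=
  delClusterProb p ends s {S : Set V | a ∈ S ∧ b ∈ S} W

omit [Fintype E] [DecidableEq E] in
/-- Closing the edges touching `W` is monotone in the configuration. -/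
lemma delConfig_mono (ends : E → Sym2 V) (W : Set V) {ω ω' : Config E} (h : ω ≤ ω') :
    delConfig ends W ω ≤ delConfig ends W ω' := by
  intro e
  by_cases he : e ∈ touches ends W
  · rw [delConfig_apply_of_mem he, delConfig_apply_of_mem he]
  · rw [delConfig_apply_of_notMem he, delConfig_apply_of_notMem he]
    exact h e

omit [Fintype E] [DecidableEq E] in
/-- «`s` reaches `a` in `G ∖ W`» is an increasing event. -/
lemma isUpperSet_resEvent (ends : E → Sym2 V) (s a : V) (W : Set V) :
    IsUpperSet {ω : Config E | a ∈ cluster ends (delConfig ends W ω) s} :=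
  fun _ _ h hω => cluster_mono (delConfig_mono ends W h) s hω

omit [Fintype E] [DecidableEq E] in
/-- `{S | a ∈ S}` is an up-set of vertex sets. -/
lemma isUpperSet_mem (a : V) : IsUpperSet {S : Set V | a ∈ S} := fun _ _ h ha => h ha

omit [Fintype E] [DecidableEq E] in
/-- `{S | a ∈ S ∧ b ∈ S}` is an up-set of vertex sets. -/
lemma isUpperSet_mem_pair (a b : V) : IsUpperSet {S : Set V | a ∈ S ∧ b ∈ S} :=
  fun _ _ h hab => ⟨h hab.1, h hab.2⟩

variable [LinearOrder R] [IsStrictOrderedRing R]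

/-- Residual probabilities are antitone in the deleted set. -/
lemma resProb_anti {p : E → R} (hp : IsProbVec p) (ends : E → Sym2 V) (s a : V) :
    Antitone (resProb p ends s a) :=
  delClusterProb_anti p hp ends s (isUpperSet_mem a)

/-- `0 ≤ resProb`. -/
lemma resProb_nonneg {p : E → R} (hp : IsProbVec p) (ends : E → Sym2 V) (s a : V) (W : Set V) :
    0 ≤ resProb p ends s a W :=
  delClusterProb_nonneg p hp ends s _ W

/-- `resProb ≤ 1`. -/
lemma resProb_le_one {p : E → R} (hp : IsProbVec p) (ends : E → Sym2 V) (s a : V) (W : Set V) :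
    resProb p ends s a W ≤ 1 :=
  delClusterProb_le_one p hp ends s _ W

/-- **Harris in the residual graph**: `x̂(W) ŷ(W) ≤ ẑ(W)` — after closing the edges touching
`W` the measure is product and the two connection events are increasing. -/
lemma resProb_mul_resProb_le_resProb2 {p : E → R} (hp : IsProbVec p) (ends : E → Sym2 V)
    (s a b : V) (W : Set V) :
    resProb p ends s a W * resProb p ends s b W ≤ resProb2 p ends s a b W := by
  unfold resProb resProb2 delClusterProb
  have e : {ω : Config E | cluster ends (delConfig ends W ω) s ∈ {S : Set V | a ∈ S ∧ b ∈ S}} =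
      {ω | a ∈ cluster ends (delConfig ends W ω) s} ∩
        {ω | b ∈ cluster ends (delConfig ends W ω) s} := by
    ext ω
    simp only [Set.mem_setOf_eq, Set.mem_inter_iff]
  rw [e]
  exact prob_mul_prob_le_prob_inter hp (isUpperSet_resEvent ends s a W)
    (isUpperSet_resEvent ends s b W)

end Residual

/-! ## The tower identities along the cluster of the avoided vertex -/

section Tower

variable {V : Type*} {E : Type*} [Fintype V] [DecidableEq V] [Fintype E] [DecidableEq E]
  {R : Type*} [CommRing R]

omit [Fintype V] [DecidableEq V] [Fintype E] [DecidableEq E] in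
/-- Connection events are symmetric. -/
lemma connEvent_comm (ends : E → Sym2 V) (u v : V) : connEvent ends u v = connEvent ends v u := by
  ext ω
  exact ⟨conn_symm, conn_symm⟩

omit [Fintype V] [Fintype E] [DecidableEq E] in
/-- «`s` reaches `a` and `b`» as a cluster event. -/
lemma connAll_pair_eq (ends : E → Sym2 V) (s a b : V) :
    connAll ends s ({a} ∪ {b}) = clusterInEvent ends s {S : Set V | a ∈ S ∧ b ∈ S} := by
  ext ω
  simp only [connAll, clusterInEvent, Set.mem_setOf_eq, Finset.mem_union, Finset.mem_singleton,
    mem_cluster]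
  constructor
  · intro h
    exact ⟨h a (Or.inl rfl), h b (Or.inr rfl)⟩
  · rintro ⟨ha, hb⟩ x (rfl | rfl)
    · exact ha
    · exact hb

omit [Fintype V] [DecidableEq V] [Fintype E] [DecidableEq E] in
/-- `{C_t ∈ univ}` is everything. -/
lemma clusterInEvent_univ (ends : E → Sym2 V) (t : V) :
    clusterInEvent ends t Set.univ = Set.univ := by
  ext ω
  simp [clusterInEvent]

omit [DecidableEq V] in
/-- **Tower identity, one marker**: `P(a ∈ C_s; s ↮ t) = E[x̂(C_t) 1_{s↮t}]`, exploring the cluster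
of `t`. -/
theorem prob_conn_avoid_eq_expect_resProb (p : E → R) (ends : E → Sym2 V) (s t a : V) :
    prob p (connAll ends s {a} ∩ avoidAll ends s {t}) =
      expect p (fun ω => resProb p ends s a (cluster ends ω t) *
        ((connEvent ends s t)ᶜ).indicator 1 ω) := by
  have h := prob_clusterIn_inter_eq_expect p ends t s Set.univ {S : Set V | a ∈ S}
  rw [clusterInEvent_univ, Set.univ_inter, connEvent_comm ends t s] at h
  rw [connAll_singleton_eq, avoidAll_singleton_eq, h]
  unfold expect
  refine Finset.sum_congr rfl fun ω _ => ?_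
  simp only [Set.indicator_univ, Pi.one_apply, one_mul, resProb]

/-- **Tower identity, two markers**: `P(a, b ∈ C_s; s ↮ t) = E[ẑ(C_t) 1_{s↮t}]`. -/
theorem prob_conn_pair_avoid_eq_expect_resProb2 (p : E → R) (ends : E → Sym2 V) (s t a b : V) :
    prob p (connAll ends s ({a} ∪ {b}) ∩ avoidAll ends s {t}) =
      expect p (fun ω => resProb2 p ends s a b (cluster ends ω t) *
        ((connEvent ends s t)ᶜ).indicator 1 ω) := by
  have h := prob_clusterIn_inter_eq_expect p ends t s Set.univ {S : Set V | a ∈ S ∧ b ∈ S}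
  rw [clusterInEvent_univ, Set.univ_inter, connEvent_comm ends t s] at h
  rw [connAll_pair_eq, avoidAll_singleton_eq, h]
  unfold expect
  refine Finset.sum_congr rfl fun ω _ => ?_
  simp only [Set.indicator_univ, Pi.one_apply, one_mul, resProb2]

omit [Fintype V] [DecidableEq V] in
/-- The avoidance probability as an expectation. -/
lemma prob_avoid_eq_expect (p : E → R) (ends : E → Sym2 V) (s t : V) :
    prob p (avoidAll ends s {t}) = expect p (fun ω => ((connEvent ends s t)ᶜ).indicator 1 ω) := by
  rw [avoidAll_singleton_eq, prob_eq_expect_indicator]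

end Tower

/-! ## The between-fibre form and the reduction -/

section Main

variable {V : Type*} {E : Type*} [Fintype V] [DecidableEq V] [Fintype E] [DecidableEq E]
  {R : Type*} [Field R] [LinearOrder R] [IsStrictOrderedRing R]

/-- **The between-fibre form (T1)**, cleared by `P(R_T)²`: with `x̂, ŷ` the residual merged
connection probabilities of the root `s` given the cluster of `t` in `H/W`, and `Q₀, X₀, Y₀` the plain
avoidance / connection probabilities,
`E_{H/W}[(x̂(C_t) Q₀ − X₀) (ŷ(C_t) Q₀ − Y₀) ; s ↛ t]`. -/
noncomputable def betweenFibre (p : E → R) (ends : E → Sym2 V) (s t : V) (W : Finset V)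
    (w₀ a b : V) : R :=
  expect p (fun ω =>
    (resProb p (contractEnds ends W w₀) s a (cluster (contractEnds ends W w₀) ω t) *
          prob p (avoidAll ends s {t}) -
        prob p (connAll ends s {a} ∩ avoidAll ends s {t})) *
      (resProb p (contractEnds ends W w₀) s b (cluster (contractEnds ends W w₀) ω t) *
          prob p (avoidAll ends s {t}) -
        prob p (connAll ends s {b} ∩ avoidAll ends s {t})) *
      ((connEvent (contractEnds ends W w₀) s t)ᶜ).indicator 1 ω)

/-- **The between-fibre product moment** `Ẑ₁ = E_{H/W}[x̂(C_t) ŷ(C_t); s ↛ t]`. -/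
noncomputable def betweenMoment (p : E → R) (ends : E → Sym2 V) (s t : V) (W : Finset V)
    (w₀ a b : V) : R :=
  expect p (fun ω =>
    resProb p (contractEnds ends W w₀) s a (cluster (contractEnds ends W w₀) ω t) *
      resProb p (contractEnds ends W w₀) s b (cluster (contractEnds ends W w₀) ω t) *
      ((connEvent (contractEnds ends W w₀) s t)ᶜ).indicator 1 ω)

/-- **(CCT-W) from the between-fibre form**: the difference is the expectation of the Harris
covariances of the residual product measures, `E[Q₀² (ẑ − x̂ ŷ)(C_t); s ↛ t] ≥ 0`. -/
theorem CCTW_of_betweenFibre (p : E → R) (hp : IsProbVec p) (ends : E → Sym2 V) (s t : V)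
    (W : Finset V) (w₀ a b : V) (h : 0 ≤ betweenFibre p ends s t W w₀ a b) :
    CCTW p ends s {t} W w₀ a b := by
  unfold CCTW
  set ends' := contractEnds ends W w₀ with hends'
  set Q0 := prob p (avoidAll ends s {t}) with hQ0
  set X0 := prob p (connAll ends s {a} ∩ avoidAll ends s {t}) with hX0
  set Y0 := prob p (connAll ends s {b} ∩ avoidAll ends s {t}) with hY0
  rw [prob_conn_pair_avoid_eq_expect_resProb2, prob_conn_avoid_eq_expect_resProb,
    prob_conn_avoid_eq_expect_resProb, prob_avoid_eq_expect]
  -- the difference from the between-fibre form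
  have key : Q0 ^ 2 * expect p (fun ω => resProb2 p ends' s a b (cluster ends' ω t) *
          ((connEvent ends' s t)ᶜ).indicator 1 ω) -
        Q0 * (X0 * expect p (fun ω => resProb p ends' s b (cluster ends' ω t) *
            ((connEvent ends' s t)ᶜ).indicator 1 ω) +
          Y0 * expect p (fun ω => resProb p ends' s a (cluster ends' ω t) *
            ((connEvent ends' s t)ᶜ).indicator 1 ω)) +
        X0 * Y0 * expect p (fun ω => ((connEvent ends' s t)ᶜ).indicator 1 ω) -
      betweenFibre p ends s t W w₀ a b =
      expect p (fun ω => Q0 ^ 2 * (resProb2 p ends' s a b (cluster ends' ω t) -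
        resProb p ends' s a (cluster ends' ω t) * resProb p ends' s b (cluster ends' ω t)) *
        ((connEvent ends' s t)ᶜ).indicator 1 ω) := by
    unfold betweenFibre
    simp only [expect, Finset.mul_sum, ← Finset.sum_sub_distrib, ← Finset.sum_add_distrib]
    refine Finset.sum_congr rfl fun ω _ => ?_
    ring
  have hnn : 0 ≤ expect p (fun ω => Q0 ^ 2 * (resProb2 p ends' s a b (cluster ends' ω t) -
        resProb p ends' s a (cluster ends' ω t) * resProb p ends' s b (cluster ends' ω t)) *
        ((connEvent ends' s t)ᶜ).indicator 1 ω) := by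
    refine expect_nonneg hp fun ω => ?_
    refine mul_nonneg (mul_nonneg (sq_nonneg _) ?_) ?_
    · exact sub_nonneg.2 (resProb_mul_resProb_le_resProb2 hp ends' s a b _)
    · exact Set.indicator_apply_nonneg fun _ => zero_le_one
  linarith [key, hnn, h]

omit [LinearOrder R] [IsStrictOrderedRing R] in
/-- `E[x̂(C_t) 1_{s↛t}]` in `H/W` is the merged connection probability `X₁`. -/
lemma expect_resProb_eq (p : E → R) (ends : E → Sym2 V) (s t : V) (W : Finset V) (w₀ a : V) :
    expect p (fun ω => resProb p (contractEnds ends W w₀) s a (cluster (contractEnds ends W w₀) ω t) *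
        ((connEvent (contractEnds ends W w₀) s t)ᶜ).indicator 1 ω) =
      prob p (connAll (contractEnds ends W w₀) s {a} ∩ avoidAll (contractEnds ends W w₀) s {t}) :=
  (prob_conn_avoid_eq_expect_resProb p _ s t a).symm

/-- **The between-fibre BHK slack is nonnegative**: `X₁ Y₁ ≤ Q₁ Ẑ₁` — BHK 1.3 (`bhk_same_cluster`)
on `H/W` for the cluster of the avoided vertex `t`, with the antitone residual functionals. -/
theorem Khat_nonneg (p : E → R) (hp : IsProbVec p) (ends : E → Sym2 V) (s t : V) (W : Finset V)
    (w₀ a b : V) :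
    prob p (connAll (contractEnds ends W w₀) s {a} ∩ avoidAll (contractEnds ends W w₀) s {t}) *
        prob p (connAll (contractEnds ends W w₀) s {b} ∩ avoidAll (contractEnds ends W w₀) s {t}) ≤
      prob p (avoidAll (contractEnds ends W w₀) s {t}) * betweenMoment p ends s t W w₀ a b := by
  set ends' := contractEnds ends W w₀ with hends'
  -- the functionals `1 − x̂`, `1 − ŷ` are monotone and nonnegative
  have hF₁ : Monotone (fun S => 1 - resProb p ends' s a S) := fun S S' h => by
    simp only
    linarith [resProb_anti hp ends' s a h]
  have hF₂ : Monotone (fun S => 1 - resProb p ends' s b S) := fun S S' h => by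
    simp only
    linarith [resProb_anti hp ends' s b h]
  have hF₁0 : ∀ S, 0 ≤ 1 - resProb p ends' s a S := fun S => by
    linarith [resProb_le_one hp ends' s a S]
  have hF₂0 : ∀ S, 0 ≤ 1 - resProb p ends' s b S := fun S => by
    linarith [resProb_le_one hp ends' s b S]
  have key := bhk_same_cluster p hp ends' t s hF₁ hF₂ hF₁0 hF₂0
  -- rewrite the avoidance `t ↮ s` as `s ↮ t`
  rw [connEvent_comm ends' t s] at key
  -- the expectations in `key`, by linearity
  have e1 : expect p (fun ω => (1 - resProb p ends' s a (cluster ends' ω t)) *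
      ((connEvent ends' s t)ᶜ).indicator 1 ω) =
      expect p (fun ω => ((connEvent ends' s t)ᶜ).indicator 1 ω) -
        expect p (fun ω => resProb p ends' s a (cluster ends' ω t) *
          ((connEvent ends' s t)ᶜ).indicator 1 ω) := by
    simp only [expect, ← Finset.sum_sub_distrib]
    refine Finset.sum_congr rfl fun ω _ => ?_
    ring
  have e2 : expect p (fun ω => (1 - resProb p ends' s b (cluster ends' ω t)) *
      ((connEvent ends' s t)ᶜ).indicator 1 ω) =
      expect p (fun ω => ((connEvent ends' s t)ᶜ).indicator 1 ω) -
        expect p (fun ω => resProb p ends' s b (cluster ends' ω t) *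
          ((connEvent ends' s t)ᶜ).indicator 1 ω) := by
    simp only [expect, ← Finset.sum_sub_distrib]
    refine Finset.sum_congr rfl fun ω _ => ?_
    ring
  have e3 : expect p (fun ω => (1 - resProb p ends' s a (cluster ends' ω t)) *
      (1 - resProb p ends' s b (cluster ends' ω t)) * ((connEvent ends' s t)ᶜ).indicator 1 ω) =
      expect p (fun ω => ((connEvent ends' s t)ᶜ).indicator 1 ω) -
        expect p (fun ω => resProb p ends' s a (cluster ends' ω t) *
          ((connEvent ends' s t)ᶜ).indicator 1 ω) -
        expect p (fun ω => resProb p ends' s b (cluster ends' ω t) *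
          ((connEvent ends' s t)ᶜ).indicator 1 ω) +
        betweenMoment p ends s t W w₀ a b := by
    unfold betweenMoment
    rw [← hends']
    simp only [expect, ← Finset.sum_sub_distrib, ← Finset.sum_add_distrib]
    refine Finset.sum_congr rfl fun ω _ => ?_
    ring
  have eQ' : prob p (connEvent ends' s t)ᶜ =
      expect p (fun ω => ((connEvent ends' s t)ᶜ).indicator 1 ω) := by
    rw [prob_eq_expect_indicator]
  rw [e1, e2, e3, eQ'] at key
  rw [prob_conn_avoid_eq_expect_resProb, prob_conn_avoid_eq_expect_resProb, prob_avoid_eq_expect]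
  -- `(Q − X)(Q − Y) ≤ (Q − X − Y + Ẑ) Q  ⟹  X Y ≤ Q Ẑ`
  nlinarith [key]

omit [LinearOrder R] [IsStrictOrderedRing R] in
/-- **Anatomy of the between-fibre form**: `Q₁ · betweenFibre = Q₀² · K̂₁ + D_a · D_b` with
`K̂₁ = Q₁ Ẑ₁ − X₁ Y₁` the between-fibre slack and `D_a = X₁ Q₀ − X₀ Q₁`, `D_b = Y₁ Q₀ − Y₀ Q₁` the
cleared displacements of the conditional means under the contraction. -/
theorem betweenFibre_anatomy (p : E → R) (ends : E → Sym2 V) (s t : V) (W : Finset V)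
    (w₀ a b : V) :
    prob p (avoidAll (contractEnds ends W w₀) s {t}) * betweenFibre p ends s t W w₀ a b =
      prob p (avoidAll ends s {t}) ^ 2 *
          (prob p (avoidAll (contractEnds ends W w₀) s {t}) * betweenMoment p ends s t W w₀ a b -
            prob p (connAll (contractEnds ends W w₀) s {a} ∩ avoidAll (contractEnds ends W w₀) s {t}) *
              prob p (connAll (contractEnds ends W w₀) s {b} ∩
                avoidAll (contractEnds ends W w₀) s {t})) +
        (prob p (connAll (contractEnds ends W w₀) s {a} ∩ avoidAll (contractEnds ends W w₀) s {t}) *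
              prob p (avoidAll ends s {t}) -
            prob p (connAll ends s {a} ∩ avoidAll ends s {t}) *
              prob p (avoidAll (contractEnds ends W w₀) s {t})) *
          (prob p (connAll (contractEnds ends W w₀) s {b} ∩ avoidAll (contractEnds ends W w₀) s {t}) *
              prob p (avoidAll ends s {t}) -
            prob p (connAll ends s {b} ∩ avoidAll ends s {t}) *
              prob p (avoidAll (contractEnds ends W w₀) s {t})) := by
  set ends' := contractEnds ends W w₀ with hends'
  set Q0 := prob p (avoidAll ends s {t}) with hQ0
  set X0 := prob p (connAll ends s {a} ∩ avoidAll ends s {t}) with hX0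
  set Y0 := prob p (connAll ends s {b} ∩ avoidAll ends s {t}) with hY0
  -- the between-fibre form expanded by linearity
  have expand : betweenFibre p ends s t W w₀ a b =
      Q0 ^ 2 * betweenMoment p ends s t W w₀ a b -
        Q0 * (X0 * expect p (fun ω => resProb p ends' s b (cluster ends' ω t) *
            ((connEvent ends' s t)ᶜ).indicator 1 ω) +
          Y0 * expect p (fun ω => resProb p ends' s a (cluster ends' ω t) *
            ((connEvent ends' s t)ᶜ).indicator 1 ω)) +
        X0 * Y0 * expect p (fun ω => ((connEvent ends' s t)ᶜ).indicator 1 ω) := by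
    unfold betweenFibre betweenMoment
    rw [← hends', ← hQ0, ← hX0, ← hY0]
    simp only [expect, Finset.mul_sum, ← Finset.sum_sub_distrib, ← Finset.sum_add_distrib]
    refine Finset.sum_congr rfl fun ω _ => ?_
    ring
  rw [expand, prob_conn_avoid_eq_expect_resProb, prob_conn_avoid_eq_expect_resProb,
    prob_avoid_eq_expect]
  ring

/-- **(CCT-W) from the slack–displacement inequality**: if `Q₀² K̂₁ + D_a D_b ≥ 0` (and `Q₁ > 0`)
then (CCT-W) holds — the open content of the free-edge rung in one inequality; with
`K̂₁ ≥ 0` (`Khat_nonneg`) it is automatic whenever the displacements are co-monotone. -/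
theorem CCTW_of_slack (p : E → R) (hp : IsProbVec p) (ends : E → Sym2 V) (s t : V)
    (W : Finset V) (w₀ a b : V)
    (hQ : 0 < prob p (avoidAll (contractEnds ends W w₀) s {t}))
    (h : 0 ≤ prob p (avoidAll ends s {t}) ^ 2 *
          (prob p (avoidAll (contractEnds ends W w₀) s {t}) * betweenMoment p ends s t W w₀ a b -
            prob p (connAll (contractEnds ends W w₀) s {a} ∩ avoidAll (contractEnds ends W w₀) s {t}) *
              prob p (connAll (contractEnds ends W w₀) s {b} ∩
                avoidAll (contractEnds ends W w₀) s {t})) +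
        (prob p (connAll (contractEnds ends W w₀) s {a} ∩ avoidAll (contractEnds ends W w₀) s {t}) *
              prob p (avoidAll ends s {t}) -
            prob p (connAll ends s {a} ∩ avoidAll ends s {t}) *
              prob p (avoidAll (contractEnds ends W w₀) s {t})) *
          (prob p (connAll (contractEnds ends W w₀) s {b} ∩ avoidAll (contractEnds ends W w₀) s {t}) *
              prob p (avoidAll ends s {t}) -
            prob p (connAll ends s {b} ∩ avoidAll ends s {t}) *
              prob p (avoidAll (contractEnds ends W w₀) s {t}))) :
    CCTW p ends s {t} W w₀ a b := by
  refine CCTW_of_betweenFibre p hp ends s t W w₀ a b ?_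
  have key := betweenFibre_anatomy p ends s t W w₀ a b
  rw [← key] at h
  exact (mul_nonneg_iff_of_pos_left hQ).1 h

end Main

end Contract

end Summit.Ventures.PercRepro2
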